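import Summits.QuantumFields.BalabanUV.Beta.MultiscaleGradientMember
import Summits.QuantumFields.BalabanUV.Beta.FlatGradientBinderD4

/-!
# `Summit.QuantumFields.BalabanUV.Beta.MultiscaleGradientMemberClosed` — engine file 19c: the GRADIENT MEMBER (3.42)₂'s SHAPE for
# `levelOp` with FLAT transport in BAŁABAN'S DIMENSION d = 4 WITH NO BINDER — file 19b's `real_grad_levelOp_inverse_le_of_flatGradient`
# with its flat Poisson interior gradient hypothesis (FG) DISCHARGED by co-owner beta-d4-p2's `FlatGradientBinderD4.flatGradient_binder_d4`
# (chain «LATTICE-GRADIENT-MEMBER»: GR1 `HarmonicGradientInterior` + GR2 `GreenGradientRowSum` + GR3 `GradientMemberBox` + road P3's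
# `GreenNewtonBoundD4`)

HONEST FRAMING (page 1 of everything in this cell).  Discharging `FlowStep.BetaPertH` would make Bałaban's ultraviolet
stability UNCONDITIONAL — a constructive-QFT result; it is NOT the continuum limit and NOT the Clay problem.  This module
discharges nothing of `BetaPertH`; it is [folklore] finite-dimensional bookkeeping about the MODEL operator, kernel-checked, by the
OWNER of binder row D4 (unit `b2b-balaban-beta-an4`, gen 46), composing the co-owners' theorem with file 19b.  HONEST DEPENDENCY:
continuum YM on T⁴ ⇐ BetaPertH ∧ nine spine estimates (0/9 proved); BetaPertH ⇐ (D1) ∧ (D4) ∧ CAP+tail; G-an2-4 gates asym, D1 and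
NE2/3/4.

THE POINT (O.2 item (i), first member, MODEL level; NOT the critical path).  File 19b proved the gradient member for `levelOp` with
FLAT transport MODULO ONE BINDER, the flat Poisson interior gradient estimate (FG) with free constants `K₁, K₂`.  Co-owner beta-d4-p2
(gen 11) proved (FG) IN FILE 19b's LETTERS for every torus `N : Fin 4 → ℕ` and constant bond weight, with `K₁ = Kgrad 4`,
`K₂ = 9/2·Kgrad 4 + 36·Cdip 4·Cps 4` — numbers depending on nothing (`flatGradient_binder_d4`: GR3's box estimate + road P3's pointwise
Green bound `green ≤ 3c₀⁻²(dist+1)^{−2}`, the small-torus case by the trivial bound).  THIS FILE is the one-line composition: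
**`real_grad_levelOp_inverse_le_d4 (hd : d = 4)`** — for `u` supported in cell `k′` with `|u| ≤ m` and every bond-component `(b,i)`,
`|(D(levelOp)⁻¹u)(b,i)| ≤ |c₀|·(𝔅(Γ²e^δ+1)·64Γ + Kgrad 4·𝔅Γ²e^δ·64Γ + (9/2·Kgrad 4 + 36·Cdip 4·Cps 4)(θ/4+1)(e^{9δ} + a_max√|Cp|𝔅e^{17δ})/c₀²)·
n(b₋)·e^{−δd_n(b₋,t_{k′})}·m` with NO binder and NO named fact: constants `c₀, c_max, a_max, C, κ, L, A, R, |Cp|` only.  So after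
gen 46 the members of [B9] Thm 3.1 in the kernel at MODEL level are: (3.46)₁, (3.42)₄, (3.42)₁, (3.47)₁ for every isometric
transport (no binder), and (3.42)₂ for FLAT transport in d = 4 (no binder) ∕ general d (modulo (FG)).  WHAT THIS IS NOT: not a bound
on Bałaban's ∇_UG′(U) — flat transport only (for rough transports the pointwise gradient member fails level-free, census E-an4-141d;
print's device is (3.35) + [B4] Lemma 2.2); row D4 readiness width 0; D4 DISCHARGE NO DATE.

WHAT IS CERTIFIED (kernel, 0 sorry, 0 def): **`real_grad_levelOp_inverse_le_d4`**.  LOCATORS (shape only; ABSOLUTE RULE — nothing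
printed is asserted): [Balaban1985BackgroundPropagators] Thm 3.1 (3.42) p. 397; [Balaban1983RegularityDecay] Lemma 2.2 (2.17)
pp. 577–578.  NOT BetaPertH, NOT continuum, NOT Clay, NOT summit progress.
-/

open scoped BigOperators
open Finset

namespace Summit.QuantumFields.BalabanUV.Beta.MultiscaleGradientMemberClosed

open Summit.QuantumFields.BalabanUV.Beta.BoxPoincare (Box)
open Summit.QuantumFields.BalabanUV.Beta.MultiscaleCoerciveTorus
open Summit.QuantumFields.BalabanUV.Beta.MultiscaleDistance
open Summit.QuantumFields.BalabanUV.Beta.MultiscaleDecayBudget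
open Summit.QuantumFields.BalabanUV.Beta.MultiscaleGradientMember (real_grad_levelOp_inverse_le_of_flatGradient)
open Summit.QuantumFields.BalabanUV.Beta.FlatGradientBinderD4 (flatGradient_binder_d4)
open Summit.QuantumFields.BalabanUV.Beta.HarmonicGradientInterior (Kgrad)
open Summit.QuantumFields.BalabanUV.Beta.TorusInversePowerSums (Cps Cps_nonneg)
open Summit.QuantumFields.BalabanUV.Beta.GreenGradientRowSum (Cdip Cdip_nonneg Kgrad_nonneg)
open Summit.QuantumFields.BalabanUV.Beta.SubsolutionMeanValueBox (Cmv)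
open Literature.MathematicalPhysics.QuantumFieldTheory.Balaban1983to89
open Literature.MathematicalPhysics.QuantumFieldTheory.Balaban1983to89.B9Thm37Glue (covD)
open Literature.MathematicalPhysics.QuantumFieldTheory.Balaban1983to89.B9Thm37GluePU (bsrc btgt)
open Literature.MathematicalPhysics.QuantumFieldTheory.Balaban1983to89.B9Thm37GlueTorusCov (tblk)
open Literature.MathematicalPhysics.QuantumFieldTheory.Balaban1983to89.B9Thm37GlueTorusCovLevels (levelOp)
open B5TorusCover (UT Ctr ctrU)
open B5Leibniz121 (up dn)

noncomputable section

variable {d : ℕ} {N : Fin d → ℕ} [∀ i, NeZero (N i)]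

variable [NeZero d] {Cp J K : Type} [Fintype Cp] [DecidableEq Cp] [Nonempty Cp]
  [Fintype J] [Fintype K] [DecidableEq K] (S : J → ℕ) (hS : ∀ l, 1 ≤ S l) (hdivS : ∀ l i, S l ∣ N i) (lvl : K → J)
  (zc : (k : K) → Ctr N (S (lvl k)))
  (hdisj : ∀ k k' v v', cellPt S hS hdivS lvl zc k v = cellPt S hS hdivS lvl zc k' v' → k = k')
  (hcover : ∀ x : UT N, ∃ k, ∃ v : Box d (S (lvl k)), cellPt S hS hdivS lvl zc k v = x)
  (Rm : UT N × Fin d → Cp → Cp → ℝ) (hRm : ∀ b i j, ∑ k, Rm b k i * Rm b k j = if i = j then (1 : ℝ) else 0)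
  (T : J → UT N → Cp → Cp → ℝ) (hT : ∀ l x i i', ∑ k, T l x k i * T l x k i' = if i = i' then (1 : ℝ) else 0)
  (a : J → ℝ) (ha : ∀ j, 0 ≤ a j) (ω : J → UT N → ℝ)
  (hsupp : ∀ l x, ω l (ctrU N (S l) (tblk (hS l) (hdivS l) x)) ≠ 0 → ∃ k v, lvl k = l ∧ cellPt S hS hdivS lvl zc k v = x)
  {amax : ℝ} (hamax : 0 ≤ amax)
  (hscale : ∀ k, a (lvl k) * ω (lvl k) (ctrU N (S (lvl k)) (zc k)) ^ 2 * (S (lvl k) : ℝ) ^ d ≤ amax / (S (lvl k) : ℝ) ^ 2)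
  (c : UT N × Fin d → ℝ) {c₀ : ℝ} (hcc : ∀ b, c b = c₀) (hc₀ : c₀ ≠ 0)
  {L : ℕ} (hL : 1 ≤ L) (e : J → ℕ) (hSe : ∀ l, S l = L ^ e l) {R : ℝ} (hR : 0 < R) {A : ℕ}
  (hadd : ∀ x y : UT N, |(e (lvl (cellOf S hS hdivS lvl zc hcover x)) : ℝ) - e (lvl (cellOf S hS hdivS lvl zc hcover y))| ≤
    A + sdist bsrc btgt (siteScale S hS hdivS lvl zc hcover) x y / R)

include hdisj hT ha hsupp hamax hscale hL e hSe hR hadd hRm hcc hc₀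

/-- **THE GRADIENT MEMBER (3.42)₂'s SHAPE FOR `levelOp`, FLAT TRANSPORT, d = 4 — NO BINDER.**  File 19b's
`real_grad_levelOp_inverse_le_of_flatGradient` with `hFG := FlatGradientBinderD4.flatGradient_binder_d4 hcc hc₀` (co-owner beta-d4-p2),
`K₁ = Kgrad 4`, `K₂ = 9/2·Kgrad 4 + 36·Cdip 4·Cps 4`: in the MODEL setting of `MultiscaleDecay.hc_levelOp` with a constant bond weight,
flat transport, the additive grading, the (P) budget and the rate condition, on a torus `N : Fin 4 → ℕ` (`hd : d = 4`), for `u`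
supported in cell `k′` with `|u| ≤ m` and every bond-component `(b, i)`:
`|(D(levelOp)⁻¹u)(b,i)| ≤ |c₀|·(…level-free…)·n(b₋)·e^{−δ·d_n(b₋,t_{k′})}·m` — nothing assumed beyond the MODEL setting.
[cite: Balaban1985BackgroundPropagators, Thm 3.1 (3.42) p.397; Balaban1983RegularityDecay, Lemma 2.2 (2.17) p.577] [folklore] -/
theorem real_grad_levelOp_inverse_le_d4 (hd : d = 4) (hflat : ∀ b k i, Rm b k i = if k = i then 1 else 0)
    {cmax : ℝ} (hc : ∀ b, |c b| ≤ cmax) {C : ℝ}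
    (hcoer : ∀ f : UT N × Cp → ℝ,
      C * ∑ k, ((S (lvl k) : ℝ) ^ 2)⁻¹ * ∑ v : Box d (S (lvl k)), ∑ i, f (cellPt S hS hdivS lvl zc k v, i) ^ 2 ≤
        ∑ p, f p * levelOp bsrc btgt c Rm (fun l x => ctrU N (S l) (tblk (hS l) (hdivS l) x))
          (fun l x => ω l (ctrU N (S l) (tblk (hS l) (hdivS l) x))) T a f p)
    {κ : ℝ} (hκ0 : 0 ≤ κ) (hκ1 : κ ≤ 1) (hμ : 0 < C - 2 * d * cmax ^ 2 * κ ^ 2 - amax * (Real.exp (2 * d * κ) - 1))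
    (hrate : (1 + d / 2) * (Real.log L / R) ≤ κ)
    {Γ θ δ 𝔅 : ℝ} (hΓ : Γ = (L : ℝ) ^ A * Real.exp (Real.log L / R * (4 * d + 1))) (hθ : θ = 1 / (4 * d * Γ))
    (hδ : δ = κ - (1 + d / 2) * (Real.log L / R))
    (h𝔅 : 𝔅 = (max (Real.sqrt (11 ^ d)) (Cmv d * Real.sqrt (21 ^ d)) / Real.sqrt (θ ^ d) +
            Real.sqrt (Fintype.card Cp) * (θ + 1) ^ 2 * (amax * Γ ^ 2 * Real.sqrt (Γ ^ d)) / (2 * c₀ ^ 2)) *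
          (Real.sqrt (Fintype.card Cp) * Real.exp (κ * ((4 * d + 1) + 2 * d)) *
            ((L : ℝ) ^ A * Real.exp (Real.log L / R * (4 * d + 1))) * (L : ℝ) ^ A * Real.sqrt (((L : ℝ) ^ A) ^ d) /
            (C - 2 * d * cmax ^ 2 * κ ^ 2 - amax * (Real.exp (2 * d * κ) - 1))) +
          Real.sqrt (Fintype.card Cp) * (θ + 1) ^ 2 / (2 * c₀ ^ 2) *
            Real.exp ((κ - (1 + d / 2) * (Real.log L / R)) * ((4 * d + 1) + 2 * d)))
    (k' : K) (u : UT N × Cp → ℝ) (hu : ∀ p, cellOf S hS hdivS lvl zc hcover p.1 ≠ k' → u p = 0)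
    {m : ℝ} (hm : 0 ≤ m) (hum : ∀ p, |u p| ≤ m) (b : UT N × Fin d) (i : Cp) :
    |covD bsrc btgt c Rm ((Ring.inverse (levelOp bsrc btgt c Rm (fun l x => ctrU N (S l) (tblk (hS l) (hdivS l) x))
        (fun l x => ω l (ctrU N (S l) (tblk (hS l) (hdivS l) x))) T a)) u) (b, i)| ≤
      |c₀| * (𝔅 * (Γ ^ 2 * Real.exp δ + 1) * (16 * d * Γ) + Kgrad d * 𝔅 * Γ ^ 2 * Real.exp δ * (16 * d * Γ) +
          (9 / 2 * Kgrad d + 36 * Cdip d * Cps d) * (θ / 4 + 1) * (Real.exp (δ * (2 * d + 1)) + amax * Real.sqrt (Fintype.card Cp) * 𝔅 * Real.exp (δ * (4 * d + 1))) /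
            c₀ ^ 2) *
        (siteScale S hS hdivS lvl zc hcover (bsrc b) : ℝ) *
        Real.exp (-(δ * sdist bsrc btgt (siteScale S hS hdivS lvl zc hcover) (bsrc b) (ctrU N (S (lvl k')) (zc k')))) * m := by
  subst hd
  have hK₁ : 0 ≤ Kgrad 4 := Kgrad_nonneg (by norm_num)
  have hK₂ : 0 ≤ 9 / 2 * Kgrad 4 + 36 * Cdip 4 * Cps 4 := by
    have h1 := Kgrad_nonneg (d := 4) (by norm_num)
    have h2 := Cdip_nonneg (d := 4) (by norm_num)
    have h3 := Cps_nonneg 4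
    positivity
  exact real_grad_levelOp_inverse_le_of_flatGradient S hS hdivS lvl zc hdisj hcover Rm hRm T hT a ha ω hsupp hamax hscale c hcc hc₀
    hL e hSe hR hadd hflat hc hcoer hκ0 hκ1 hμ hrate hΓ hθ hδ h𝔅 hK₁ hK₂ (flatGradient_binder_d4 hcc hc₀) k' u hu hm hum b i

end

end Summit.QuantumFields.BalabanUV.Beta.MultiscaleGradientMemberClosed
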